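import Literature.NumberTheory.NumberFields.PrincipalDivisorTransportGalois
import HarnessLib

/-!
# A transport of principal arithmetic divisors along place permutations: where the finite places go

Classical algebraic number theory (PROOF-ONLY; no definitions, no named facts), continuing
`NumberFields/PrincipalDivisorTransportGalois`.  For `L/ℚ` Galois and a transport `Γ` of `Φ(L)^gp` relabelling
finite places by `ρ_f`, infinite places by `ρ_∞ = (s • ·)` (`s ∈ Gal(L/ℚ)`) and principal divisors to principal
divisors, `exists_maximalIdeal_rho_eq_smul` says **where the finite places go**: for every prime `𝔔` of `𝓞 L` the
prime at `ρ_f(𝔔)` is `(s z₁ z₂) • 𝔔` with `z₁, z₂` in the stabiliser of a chosen infinite place (so `= s • 𝔔` when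
the Galois action on infinite places is free, and `∈ {s • 𝔔, s c • 𝔔}` in the CM case).  (Primes with PRESCRIBED
decomposition group — the other input of the CM case — are `NumberFields/DecompositionGroupsPrescribed`.)
Use: the CM case of [FrdI] Thm. 6.4 (iv)'s compatibility clause at the data (cell abc-iut, G-L1t3-1 #2).  Nothing
here is specific to the disputed corpus.
-/

noncomputable section

open NumberField NumberField.InfinitePlace IsDedekindDomain
open Literature.AlgebraicGeometry.Frobenioids

open scoped Pointwise

namespace Literature.NumberTheory.NumberFields

variable {L : Type} [Field L] [NumberField L]

/-! ### Where the finite places go -/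

/-- **The finite part of the transport moves every prime by `s`, up to the stabiliser of an infinite place**:
with `ρ_∞ = (s • ·)`, the prime at `ρ_f(𝔔)` is `(s z₁ z₂) • 𝔔` for some `z₁, z₂ ∈ Stab(v₀)`.
[cite: MochizukiFrdI2008, Thm. 6.4 (iv) p.115] -/
theorem exists_maximalIdeal_rho_eq_smul [IsGalois ℚ L] (Γ : ArithDivisor L →+ ArithDivisor L)
    (ρf : FinitePlace L ≃ FinitePlace L) (ρi : InfinitePlace L ≃ InfinitePlace L)
    (hfin : ∀ (d : ArithDivisor L) (w : FinitePlace L), (Γ d).1 (ρf w) = d.1 w)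
    (harch : ∀ (d : ArithDivisor L) (v : InfinitePlace L), (Γ d).2 (ρi v) = d.2 v)
    (hprinc : ∀ x : Lˣ, ∃ y : Lˣ, Γ (principalArithDivisor L x) = principalArithDivisor L y)
    {s : L ≃ₐ[ℚ] L} (hs : ∀ v : InfinitePlace L, ρi v = s • v) (v₀ : InfinitePlace L)
    (𝔔 : HeightOneSpectrum (𝓞 L)) :
    ∃ z₁ z₂ : L ≃ₐ[ℚ] L, z₁ • v₀ = v₀ ∧ z₂ • v₀ = v₀ ∧
      (ρf (FinitePlace.mk 𝔔)).maximalIdeal.asIdeal = (s * z₁ * z₂) • 𝔔.asIdeal := by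
  classical
  obtain ⟨h, X, hh, hX0, hX⟩ := exists_span_singleton_eq_pow 𝔔
  have hXL : (X : L) ≠ 0 := fun h0 => hX0 (by exact_mod_cast h0)
  set x : Lˣ := Units.mk0 (X : L) hXL with hx
  obtain ⟨y, hy⟩ := hprinc x
  have hordy : ∀ w : FinitePlace L, ordFin L w y = ordFin L (ρf.symm w) x := fun w => by
    have := hfin (principalArithDivisor L x) (ρf.symm w)
    rw [hy, Equiv.apply_symm_apply, principalArithDivisor_fst, principalArithDivisor_fst] at this
    exact this
  have hordx : ∀ w : FinitePlace L,
      ordFin L w x = multiplicity w.maximalIdeal.asIdeal (Ideal.span {X}) := fun w => by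
    conv_lhs => rw [← FinitePlace.mk_maximalIdeal w]
    exact ordFin_mk_mk0_eq_multiplicity w.maximalIdeal hX0 hXL
  obtain ⟨Y, hY⟩ := exists_ringOfIntegers_coe_eq y fun w => by
    rw [hordy, hordx]; exact Int.natCast_nonneg _
  have hYL : (Y : L) ≠ 0 := by rw [hY]; exact y.ne_zero
  have hY0 : Y ≠ 0 := fun h0 => hYL (by rw [h0]; rfl)
  have hyY : y = Units.mk0 (Y : L) hYL := Units.ext hY.symm
  set 𝔔' : HeightOneSpectrum (𝓞 L) := (ρf (FinitePlace.mk 𝔔)).maximalIdeal with h𝔔'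
  have hspanY : Ideal.span {Y} = 𝔔'.asIdeal ^ h := by
    refine ideal_eq_of_forall_multiplicity_eq (by simpa [Ideal.span_singleton_eq_bot] using hY0)
      (pow_ne_zero _ 𝔔'.ne_bot) fun v => ?_
    have h1 : (multiplicity v.asIdeal (Ideal.span {Y}) : ℤ) =
        multiplicity (ρf.symm (FinitePlace.mk v)).maximalIdeal.asIdeal (Ideal.span {X}) := by
      rw [← ordFin_mk_mk0_eq_multiplicity v hY0 hYL, ← hyY, hordy, hordx]
    have h2 : (ρf.symm (FinitePlace.mk v)).maximalIdeal = 𝔔 ↔ v = 𝔔' := by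
      constructor
      · intro h3
        have h4 : ρf.symm (FinitePlace.mk v) = FinitePlace.mk 𝔔 := by
          rw [← FinitePlace.mk_maximalIdeal (ρf.symm (FinitePlace.mk v)), h3]
        have h5 : FinitePlace.mk v = ρf (FinitePlace.mk 𝔔) := by rw [← h4, Equiv.apply_symm_apply]
        rw [h𝔔', ← h5, FinitePlace.maximalIdeal_mk]
      · intro h3
        rw [h3, h𝔔', FinitePlace.mk_maximalIdeal, Equiv.symm_apply_apply, FinitePlace.maximalIdeal_mk]
    rw [hX] at h1
    by_cases hv : v = 𝔔'
    · have h3 : (ρf.symm (FinitePlace.mk v)).maximalIdeal = 𝔔 := h2.mpr hv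
      rw [h3, multiplicity_pow_self_of_prime 𝔔.prime] at h1
      subst hv
      rw [multiplicity_pow_self_of_prime 𝔔'.prime]
      exact_mod_cast h1
    · have hne : (ρf.symm (FinitePlace.mk v)).maximalIdeal ≠ 𝔔 := fun h' => hv (h2.mp h')
      rw [multiplicity_asIdeal_pow_of_ne hne] at h1
      rw [multiplicity_asIdeal_pow_of_ne hv]
      exact_mod_cast h1
  have harchy : (ρi v₀) (Y : L) = v₀ (X : L) := by
    have := harch (principalArithDivisor L x) v₀
    rw [hy, principalArithDivisor_snd, principalArithDivisor_snd, neg_inj, hyY, Units.val_mk0, hx,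
      Units.val_mk0] at this
    exact Real.log_injOn_pos ((ρi v₀).pos_iff.mpr hYL) (v₀.pos_iff.mpr hXL) this
  obtain ⟨t, c, hw, hcv, hor⟩ :=
    smul_eq_or_of_apply_eq_of_span_eq 𝔔.isMaximal 𝔔'.isMaximal hh hX hspanY v₀ (ρi v₀) harchy
  -- `s • v₀ = t⁻¹ • v₀`, so `z₁ := s⁻¹ t⁻¹ ∈ Stab(v₀)`
  rw [hs v₀] at hw
  have hz : (s⁻¹ * t⁻¹) • v₀ = v₀ := by rw [mul_smul, ← hw, inv_smul_smul]
  rcases hor with h1 | h1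
  · refine ⟨s⁻¹ * t⁻¹, 1, hz, one_smul _ _, ?_⟩
    rw [mul_one, ← mul_assoc, mul_inv_cancel, one_mul, ← h1, inv_smul_smul]
  · refine ⟨s⁻¹ * t⁻¹, c, hz, hcv, ?_⟩
    rw [← mul_assoc, mul_inv_cancel, one_mul, mul_smul, ← h1, inv_smul_smul]

end Literature.NumberTheory.NumberFields

end
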